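import Summits.HodgeConjecture.HodgeConjecture.Theses.PadicSemiregularLift
import Summits.HodgeConjecture.HodgeConjecture.Theorems.FormalVectorBundlesAlgebraize.Negative.TowerTightness
import Literature.AlgebraicGeometry.Resolution.ChowLemmaRing
import Literature.AlgebraicGeometry.KTheory.PullbackVectorBundle
import Literature.AlgebraicGeometry.Morphisms.CechModule
import Literature.AlgebraicGeometry.Morphisms.FormalFunctions
import Literature.AlgebraicGeometry.Modules.SheafHom
import Literature.AlgebraicGeometry.Modules.LinearOverBase
import Mathlib.LinearAlgebra.FreeModule.StrongRankCondition
import Summits.HodgeConjecture.HodgeConjecture.Theorems.PadicSemiregularLiftFormalVectorBundlesAlgebraizeChowCoverNormal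
import Summits.HodgeConjecture.HodgeConjecture.Theorems.PadicSemiregularLiftFormalVectorBundlesAlgebraizeModuleBockstein
import Summits.HodgeConjecture.HodgeConjecture.Theorems.PadicSemiregularLiftFormalVectorBundlesAlgebraizeFormallyFreeCokernel

/-!
# Line `chow-zariski-pushforward` (lead's RESHAPED skeleton) for the crux
`PadicSemiregularLift.FormalVectorBundlesAlgebraize` (stmt-HodgeConjecture-14106)

Lead prover `prover-line-stmt-HodgeConjecture-14106-0`, 2026-08-16. Picked line
`chow-zariski-pushforward` (PICKED.md); this file is the planner's checked skeleton
(`Cruxes/FormalVectorBundlesAlgebraize/Lines/chow-zariski-pushforward.lean`, rc 0) RESHAPED at the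
skeleton level (L1/L4 of the line protocol):

* the three frame stubs (`stub_integralNormal`, `stub_chowCover`, `stub_birationalOntoNormal`) are
  MERGED into one frame stub `stub_chowCoverNormal` (all three are hypothesis checks of proved tree
  theorems: `ChowLemmaRing.chow_proper`, `ZariskiChow.flat_of_isIntegral_of_surjective`,
  `TowardsNormal.isIso_app`; one worker);
* the XL engine stub `stub_projectiveFlatEngine` (= `ProjectiveFlatEngineStrong`, Grothendieck
  existence for vector bundles on a `W`-flat closed `Z ⊆ ℙᴺ_W`) is SPLIT along the seams of the
  on-`Z` proof (no coherent sheaves on `ℙᴺ`, no twisting sheaves in any signature):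
  - `stub_serreVanishingPackage` (EA, lead-held): Serre's theorems A and B₁ on `Z`, PACKAGED
    definition-free — every vector bundle `F` on `Z_1` is, after push-forward to `Z`, a quotient of a
    vector bundle `L` on `Z` with `Ȟ¹(𝒰, 𝓗om(L, ι_{1*}F)) = 0` (tree `CechMH1`, `sheafHom`);
  - `stub_towerPresentation` (EB1): from EA's package and the `W`-flat `p`-adic ladders, COMPATIBLE
    finite presentations `u_n : V'|Z_{n+1} → V|Z_{n+1}` of the `F n` by two FIXED vector bundles
    `V, V'` on `Z` (two rounds: lift generating sections along `Ȟ¹ = 0`, nilpotent Nakayama, the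
    kernel tower is again a flat tower of vector bundles);
  - `stub_moduleBockstein` (EC): ONE-LEVEL `H⁰` formal functions for a vector bundle `M` on a proper
    `A`-scheme (`A` Noetherian) and an `M`-regular `a ∈ A` — sections of `M/a^{n+1+c}` reduce mod
    `a^{n+1}` to algebraic sections, `c` the exponent of `Ȟ¹(𝒰, M)[a^∞]` (tree: dévissage finiteness
    `Devissage.devissage` + `DevissageHeart.heart_holds`, `CechModuleExact.cechDelta`); shared by
    the transport stub and by EB2, which take its statement as an explicit hypothesis;
  - `stub_presentationAlgebraize` (EB2): a compatible family `(u_n)` of maps between the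
    restrictions of two vector bundles on the `W`-flat proper `Z` is the restriction of ONE
    algebraic `w : V' ⟶ V` (EC + `p`-adic completeness of the finite `W`-module `Hom(V', V)`);
  - `stub_formallyFreeCokernel` (ED, = line `twist-presentation-completeness` S4 VERBATIM): a
    formally locally free cokernel of a map of vector bundles on a proper `W`-scheme is locally free
    (Fitting ideals + Krull + GW II 24.96);
* `stub_pushforwardTransport` keeps the planner's signature, prefixed by EC's statement as a
  hypothesis (the one-level frame lift is EC applied to `E'` over the affine pieces of `𝒳`).

Composition (sorry-free, §4): `engine_of_stubs : EA → EB1 → EB2(EC) → ED ⇒ ProjectiveFlatEngineStrong`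
and `FormalVectorBundlesAlgebraize_of : FormalVectorBundlesAlgebraize` — the crux BY NAME,
hypothesis-free (`sorryAx` enters only through the seven `stub_*`).

Disproof.lean (cdisprove cycles 1–2) honoured as in the planner's card: `IsProper` is consumed by the
frame (Chow), by ED/EC (dévissage finiteness, 24.96) and by the transport; the whole tower is
consumed (EB1); no uniqueness is claimed; `crux_iff_levelOne` is the shape of the final glue.
-/

set_option linter.dupNamespace false

noncomputable section

open CategoryTheory CategoryTheory.Limits AlgebraicGeometry
open Literature.AlgebraicGeometry.Motives Literature.AlgebraicGeometry.Motives.WittScheme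
open Literature.AlgebraicGeometry.Resolution
open Literature.AlgebraicGeometry.Morphisms (CechMH1 algebraMapΓ)
open Literature.AlgebraicGeometry.Modules (sheafHom globalScalar)
open Summit.HodgeConjecture.HodgeConjecture.Theorems.FormalVectorBundlesAlgebraize.Negative
  (thickeningMap_snd)

namespace Summit.HodgeConjecture.HodgeConjecture.Cruxes.FormalVectorBundlesAlgebraize.ChowZariskiPushforward

universe u

/-! ## §1 Named statements (the registered stubs of §2 restate them verbatim) -/

/-- EC statement — **one-level `H⁰` formal functions for a vector bundle (module Bockstein lemma).**
For `A` Noetherian, `f : X → Spec A` proper, `a ∈ A` and a vector bundle `M` on `X` on which `a` is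
regular (`Mono (a · 𝟙_M)`), there is `c` such that for every `n` every global section of
`M / a^{n+1+c} M` reduces modulo `a^{n+1}` to the class of a GLOBAL section of `M`. Here
`M / a^m M := cokernel (globalScalar M (algebraMapΓ f (a ^ m)))` and the reduction map `r` is ANY
morphism of the cokernels under `M` (it is unique: `cokernel.π` is epi). Paper: `H := Ȟ¹(𝒰, M)` is a
finite `A`-module (dévissage on the proper `X`), so `a^c` kills `H[a^∞]`; the Bockstein maps of
`0 → M →(a^N) M → M/a^N → 0` for `N = n+1+c` and `N = n+1` are linked by `(a^c, id, r)`, whence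
`δ_{n+1}(r t) = a^c δ_N(t) = 0` and `r t` lifts (exactness of `Ȟ⁰`). Stacks 02OB(3); EGA III₁ 4.1.5/4.1.7;
the tree's `FormalFunctionsCechProofs.hasSurjectiveFormalFunctions_of_finite_cechH1` is the case
`M = 𝒪`. -/
def ModuleBockstein : Prop :=
  ∀ (A : Type) [CommRing A] [IsNoetherianRing A] (X : Scheme.{0}) (f : X ⟶ Spec (.of A))
    [IsProper f] (a : A) (M : X.Modules), IsVectorBundle M →
    Mono (globalScalar M (algebraMapΓ f a)) →
    ∃ c : ℕ, ∀ (n : ℕ)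
      (r : cokernel (globalScalar M (algebraMapΓ f (a ^ (n + 1 + c)))) ⟶
        cokernel (globalScalar M (algebraMapΓ f (a ^ (n + 1))))),
      cokernel.π (globalScalar M (algebraMapΓ f (a ^ (n + 1 + c)))) ≫ r =
        cokernel.π (globalScalar M (algebraMapΓ f (a ^ (n + 1)))) →
      ∀ t : Γ(cokernel (globalScalar M (algebraMapΓ f (a ^ (n + 1 + c)))), ⊤),
        ∃ s : Γ(M, ⊤),
          (cokernel.π (globalScalar M (algebraMapΓ f (a ^ (n + 1))))).app ⊤ s = r.app ⊤ t

/-- FRAME statement — **Chow cover of a smooth proper model with `ρ_* 𝒪 = 𝒪`.** For `k` perfect of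
characteristic `p` and `𝒳/W(k)` a smooth proper model: there are a `W`-scheme `𝒳'`, INTEGRAL,
`W`-PROJECTIVE (`ChowLemmaRing.IsProjOver`: closed `W`-immersion into some `ℙᴺ_W`) and `W`-FLAT, and a
`W`-morphism `ρ : 𝒳' ⟶ 𝒳` with `ρ.left` proper and `𝒪_𝒳(U) ≅ 𝒪_{𝒳'}(ρ⁻¹U)` for EVERY open `U`.
Paper: `𝒳` is integral (smooth over the reduced `W` ⇒ reduced,
`Resolution.isReduced_of_smooth_of_isReduced_base`; flat ⇒ universally open with geometrically
irreducible generic fibre ⇒ irreducible, `ZariskiChow.irreducibleSpace_of_genericFibre`; pattern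
`GoodReductionZariskiProofs.isIntegral_total`), surjects onto `Spec W` (both fibres non-empty) and
has normal local rings (smooth over the regular `W` ⇒ regular stalks,
`isRegularLocalRing_stalk_of_smoothOfRelativeDimension_specOfRegular`, ⇒ integrally closed,
`isIntegrallyClosed_of_isRegularLocalRing`); Chow's lemma `ChowLemmaRing.chow_proper 𝒳.left 𝒳.hom`
gives `X'` integral, `ι : X' ↪ ℙᴺ_W` closed, `π` proper surjective, iso over a dense open; put
`𝒳' := Over.mk (π ≫ 𝒳.hom)`, `ρ := Over.homMk π`; `Flat 𝒳'.hom` by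
`ZariskiChow.flat_of_isIntegral_of_surjective` (`W(k)` a DVR, `WittVector.isDiscreteValuationRing`);
`IsIso (ρ.app U)` by Zariski / Stacks 0AY8 = `TowardsNormal.isIso_app` (universally closed ✓, `𝒳`
integral with integrally closed stalks ✓, `X'` reduced ✓, generic point of `X'` over the generic
point `ξ` of `𝒳` since it lies in `π⁻¹U ≅ U`, generic fibre `Spec κ(ξ)`). Size L (three M pieces). -/
def ChowCoverNormal : Prop :=
  ∀ (p : ℕ) [Fact p.Prime] (k : Type) [Field k] [CharP k p] [PerfectRing k p] (d : ℕ)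
    (𝒳 : SchemeOver (WittVector p k)), IsSmoothProperModel d 𝒳 →
    ∃ (𝒳' : SchemeOver (WittVector p k)) (ρ : 𝒳' ⟶ 𝒳),
      IsIntegral 𝒳'.left ∧ ChowLemmaRing.IsProjOver 𝒳' ∧ Flat 𝒳'.hom ∧ IsProper ρ.left ∧
        ∀ U : 𝒳.left.Opens, IsIso (ρ.left.app U)

/-- EA statement — **Serre's theorems A and B₁ on a `W`-projective scheme, packaged.** For `Z` a closed
`W`-subscheme of some `ℙᴺ_W` (`W = W(k)`, `k` perfect, so `W` is Noetherian) there is a finite affine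
open cover `𝒰 = (U_i)` of `Z` such that for every vector bundle `F` on the first thickening
`Z_1 = Z ⊗ W/p`, its push-forward `ι_{1*}F` to `Z` is a quotient of a vector bundle `L` on `Z` with
`Ȟ¹(𝒰, 𝓗om(L, ι_{1*}F)) = 0`. Paper: `𝒰 = (Z ∩ D₊(x_i))_i`; `L = 𝒪_Z(−m)^r` for `m ≫ 0`: Serre A
(`(ι_{1*}F)(m)` generated by finitely many global sections — affine-locally finitely generated,
extend `x_i^m s` from `D₊(x_i)` by the numerator/torsion properties of quasi-coherent modules) and
Serre B₁ (`Ȟ¹(𝒰, G(m)) = 0`, `m ≫ 0`, for every coherent `G` on `Z`, by induction on the number of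
coordinate hyperplanes meeting `supp G`: split off the `x_i`-power torsion, `0 → G(m−1) → G(m) →
G_H(m) → 0` with `G_H` on the hyperplane, finiteness of `Ȟ¹` (dévissage) and "`x_i^ν` kills every
class"); `𝓗om(𝒪(−m)^r, G) = G(m)^r`. Hartshorne II 5.17, III 5.2; Serre FAC nᵒ 66; EGA III₁ 2.2.1. -/
def SerreVanishingPackage : Prop :=
  ∀ (p : ℕ) [Fact p.Prime] (k : Type) [Field k] [CharP k p] [PerfectRing k p]
    (Z : SchemeOver (WittVector p k)), ChowLemmaRing.IsProjOver Z →
    ∃ (ι : Type) (_ : Finite ι) (U : ι → Z.left.Opens),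
      (∀ i, IsAffineOpen (U i)) ∧ (⨆ i, U i) = ⊤ ∧
      ∀ (F : (thickening Z 1).left.Modules), IsVectorBundle F →
        ∃ (L : Z.left.Modules), IsVectorBundle L ∧
          (∃ π : L ⟶ (Scheme.Modules.pushforward (thickeningι Z 1)).obj F, Epi π) ∧
          Subsingleton (CechMH1 Z.hom
            (sheafHom L ((Scheme.Modules.pushforward (thickeningι Z 1)).obj F)) U)

section TowerIso

variable {p : ℕ} [Fact p.Prime] {k : Type} [CommRing k] (Z : SchemeOver (WittVector p k))

/-- The canonical identification `(M|Z_{n+2})|Z_{n+1} ≅ M|Z_{n+1}` along `Z_{n+1} ⟶ Z_{n+2} ⟶ Z =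
Z_{n+1} ⟶ Z` (Mathlib `pullbackComp`, `pullbackCongr`, tree `thickeningMap_ι`). An `abbrev`: the
stubs spell it out. -/
abbrev towerRestrictIso (n : ℕ) (M : Z.left.Modules) :
    (Scheme.Modules.pullback (thickeningMap Z (Nat.le_succ (n + 1)))).obj
        ((Scheme.Modules.pullback (thickeningι Z (n + 2))).obj M) ≅
      (Scheme.Modules.pullback (thickeningι Z (n + 1))).obj M :=
  (Scheme.Modules.pullbackComp (thickeningMap Z (Nat.le_succ (n + 1))) (thickeningι Z (n + 2))).app M ≪≫
    (Scheme.Modules.pullbackCongr (thickeningMap_ι Z (Nat.le_succ (n + 1)))).app M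

end TowerIso

/-- EB1 statement — **compatible finite presentations of a formal vector bundle by two fixed algebraic
vector bundles.** `Z` closed in `ℙᴺ_W` and FLAT over `W`; `𝒰` a finite affine open cover of `Z` with
the Serre package of `SerreVanishingPackage` (hypothesis); `(F n)` vector bundles on `Z_{n+1}` with
`F (n+1)|Z_{n+1} ≅ F n`. THEN there are vector bundles `V, V'` on `Z` and morphisms
`u_n : V'|Z_{n+1} ⟶ V|Z_{n+1}` with `coker u_n ≅ F n`, COMPATIBLE: `u_{n+1}|Z_{n+1} = u_n` (through
`towerRestrictIso`). Paper (EGA III₁ 5.2.3–5.2.4 for vector bundles, on `Z` itself): push the tower to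
`Z`, `G_n := ι_{n+1,*} F n`; flatness of `Z` and local freeness give the ladders `0 → G_0 → G_n →
G_{n−1} → 0`; ROUND 1: the package for `F 0` gives `V` with `V ↠ G_0` and `Ȟ¹(𝓗om(V, G_0)) = 0`, so
`Hom(V, G_n) → Hom(V, G_{n−1})` is onto (long exact Čech sequence of `0 → 𝓗om(V,G_0) → 𝓗om(V,G_n) →
𝓗om(V,G_{n−1}) → 0`, `𝓗om(V,−)` exact) and compatible `v_n : V → G_n` exist, surjective by nilpotent
Nakayama (`G_n = im v_n + p^n G_n`, `p^{2n} G_n = 0`); ROUND 2: the level kernels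
`K_n := ker(V|Z_{n+1} → F n)` are vector bundles forming again such a tower (`K_{n+1}|Z_{n+1} ≅ K_n`:
`v_{n+1}` lifts `v_n`, pull-back of a short exact sequence with locally free cokernel stays exact), so
the package for `K_0` gives `V'` and compatible surjections `w_n : V'|Z_{n+1} ↠ K_n`; `u_n := w_n ≫
(K_n ↪ V|Z_{n+1})`. -/
def TowerPresentation : Prop :=
  ∀ (p : ℕ) [Fact p.Prime] (k : Type) [Field k] [CharP k p] [PerfectRing k p]
    (Z : SchemeOver (WittVector p k)), ChowLemmaRing.IsProjOver Z → Flat Z.hom →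
    ∀ (ι : Type) [Finite ι] (U : ι → Z.left.Opens), (∀ i, IsAffineOpen (U i)) → (⨆ i, U i) = ⊤ →
    (∀ (F : (thickening Z 1).left.Modules), IsVectorBundle F →
        ∃ (L : Z.left.Modules), IsVectorBundle L ∧
          (∃ π : L ⟶ (Scheme.Modules.pushforward (thickeningι Z 1)).obj F, Epi π) ∧
          Subsingleton (CechMH1 Z.hom
            (sheafHom L ((Scheme.Modules.pushforward (thickeningι Z 1)).obj F)) U)) →
    ∀ (F : ∀ n : ℕ, (thickening Z (n + 1)).left.Modules), (∀ n, IsVectorBundle (F n)) →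
      (∀ n, Nonempty ((Scheme.Modules.pullback (thickeningMap Z (Nat.le_succ (n + 1)))).obj
        (F (n + 1)) ≅ F n)) →
      ∃ (V V' : Z.left.Modules) (u : ∀ n : ℕ,
          (Scheme.Modules.pullback (thickeningι Z (n + 1))).obj V' ⟶
            (Scheme.Modules.pullback (thickeningι Z (n + 1))).obj V),
        IsVectorBundle V ∧ IsVectorBundle V' ∧
        (∀ n, (Scheme.Modules.pullback (thickeningMap Z (Nat.le_succ (n + 1)))).map (u (n + 1)) =
          (towerRestrictIso Z n V').hom ≫ u n ≫ (towerRestrictIso Z n V).inv) ∧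
        ∀ n, Nonempty (cokernel (u n) ≅ F n)

/-- EB2 statement — **algebraization of a compatible family of morphisms of vector bundles** (`H⁰`
formal functions for `𝓗om(V', V)` on the proper `W`-flat `Z`, full form, from the one-level form
`ModuleBockstein` taken as a hypothesis for `Z`). `V, V'` vector bundles on `Z`, `u_n : V'|Z_{n+1} ⟶
V|Z_{n+1}` compatible through `towerRestrictIso`; THEN `u_n = w|Z_{n+1}` for ONE `w : V' ⟶ V`.
Paper: `M := 𝓗om(V', V)` is a vector bundle on `Z`, `p` is `M`-regular (`Z` flat over `W`),
`Hom(V'|Z_{n+1}, V|Z_{n+1}) = Γ(Z, M/p^{n+1}M)` (unit `V → ι_*ι^*V` is onto with kernel `p^{n+1}V`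
for the closed immersion `Z_{n+1} ↪ Z`, `𝓗om(V', −)` exact); by `ModuleBockstein` each `u_{n+c}`
reduces mod `p^{n+1}` to an algebraic `w^{(n)}`; `w^{(n+1)} − w^{(n)} ∈ p^{n+1} Γ(Z, M)` and `Γ(Z, M)`
is a finite `W`-module (dévissage), `p`-adically complete (`Resolution.isAdicComplete_of_finite`), so
`w := lim w^{(n)}` satisfies `w|Z_{n+1} = u_n` (`p^{n+1} = 0` on `Z_{n+1}`). -/
def PresentationAlgebraize : Prop :=
  ∀ (p : ℕ) [Fact p.Prime] (k : Type) [Field k] [CharP k p] [PerfectRing k p]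
    (Z : SchemeOver (WittVector p k)), ChowLemmaRing.IsProjOver Z → Flat Z.hom →
    (∀ (M : Z.left.Modules), IsVectorBundle M →
      Mono (globalScalar M (algebraMapΓ Z.hom (p : WittVector p k))) →
      ∃ c : ℕ, ∀ (n : ℕ)
        (r : cokernel (globalScalar M (algebraMapΓ Z.hom ((p : WittVector p k) ^ (n + 1 + c)))) ⟶
          cokernel (globalScalar M (algebraMapΓ Z.hom ((p : WittVector p k) ^ (n + 1))))),
        cokernel.π (globalScalar M (algebraMapΓ Z.hom ((p : WittVector p k) ^ (n + 1 + c)))) ≫ r =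
          cokernel.π (globalScalar M (algebraMapΓ Z.hom ((p : WittVector p k) ^ (n + 1)))) →
        ∀ t : Γ(cokernel (globalScalar M (algebraMapΓ Z.hom ((p : WittVector p k) ^ (n + 1 + c)))), ⊤),
          ∃ s : Γ(M, ⊤),
            (cokernel.π (globalScalar M (algebraMapΓ Z.hom ((p : WittVector p k) ^ (n + 1))))).app ⊤ s =
              r.app ⊤ t) →
    ∀ (V V' : Z.left.Modules), IsVectorBundle V → IsVectorBundle V' →
    ∀ (u : ∀ n : ℕ,
        (Scheme.Modules.pullback (thickeningι Z (n + 1))).obj V' ⟶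
          (Scheme.Modules.pullback (thickeningι Z (n + 1))).obj V),
      (∀ n, (Scheme.Modules.pullback (thickeningMap Z (Nat.le_succ (n + 1)))).map (u (n + 1)) =
        (towerRestrictIso Z n V').hom ≫ u n ≫ (towerRestrictIso Z n V).inv) →
      ∃ w : V' ⟶ V, ∀ n, (Scheme.Modules.pullback (thickeningι Z (n + 1))).map w = u n

/-- ED statement (= line `twist-presentation-completeness`, stub S4, verbatim) — **a formally locally
free cokernel is locally free.** `Z` proper over `W = W(k)`; `u : V' ⟶ V` a morphism of vector bundles
on `Z`; if `(coker u)|Z_{n+1}` is a vector bundle for every `n` then `coker u` is a vector bundle.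
Paper: at `z ∈ Z_k` the stalk `N = (coker u)_z` is finitely presented over the Noetherian local
`B = 𝒪_{Z,z} ∋ p` with `N/pⁿN` free of rank `r` over `B/pⁿ` for all `n`; Fitting ideals commute with
base change, so `Fitt_j(N) ⊆ ⋂ₙ pⁿB = 0` for `j < r` (Krull) and `Fitt_r(N) + pB = B`, i.e.
`Fitt_r(N) = B`; hence `N` is free (tree `FittingIdeal.Module.nonempty_basis_iff_fittingIdeal`), so
`coker u` is free on a neighbourhood of `z` (Fitting ideals localise, finitely generated); the free
locus is an open `U ⊇ Z_k`, and `U = Z` because `Z → Spec W` is a closed map into a local scheme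
(GW II Lemma 24.96). Görtz–Wedhorn II Prop 24.95/Lemma 24.96; Stacks 07ZD; Matsumura 8.10. -/
def FormallyFreeCokernel : Prop :=
  ∀ (p : ℕ) [Fact p.Prime] (k : Type) [Field k] [CharP k p] [PerfectRing k p]
    (Z : SchemeOver (WittVector p k)), IsProper Z.hom →
    ∀ (V V' : Z.left.Modules) (u : V' ⟶ V), IsVectorBundle V → IsVectorBundle V' →
      (∀ n : ℕ, IsVectorBundle ((Scheme.Modules.pullback (thickeningι Z (n + 1))).obj (cokernel u))) →
      IsVectorBundle (cokernel u)

/-- TRANSPORT statement (planner's `PushforwardTransport`, prefixed by `ModuleBockstein` as a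
hypothesis) — **push-forward transport along a Chow cover with `ρ_* 𝒪 = 𝒪`** (THE LEVER of the
frame; level-`0` conclusion). Data: `𝒳` proper over `W = W(k)`; `ρ : 𝒳' ⟶ 𝒳` a `W`-morphism with
`ρ.left` proper and `𝒪_𝒳(U) ≅ 𝒪_{𝒳'}(ρ⁻¹U)` for all opens `U`; `𝒳'` `W`-projective and `W`-flat;
`(E n)` vector bundles on the thickenings `X_{n+1}` with `E (n+1)|_{X_{n+1}} ≅ E n`; `E'` a vector
bundle on `𝒳'` with `E'|_{X'_{n+1}} ≅ ρ_{n+1}^* (E n)` for all `n`. Conclusion: `ρ_* E'` is a vector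
bundle on `𝒳` and `(ρ_* E')|_{X_1} ≅ E 0`. Paper (card chow-frame-descent (L), triage-sharpened):
over an affine `V = Spec A ⊆ 𝒳` on which every `E n|_{V_{n+1}}` is free; `E'|_{ρ⁻¹V}` is
`p`-torsion-free (`Flat 𝒳'.hom`); `ModuleBockstein` for `M = E'|_{ρ⁻¹V}` over `ρ⁻¹V → Spec A`
(proper) and `a = p` gives `c`; the reduction mod `p` of the level-`(c+1)` frame (pulled back from
`E c`) lifts to `σ : 𝒪^e → E'|_{ρ⁻¹V}`; `σ` is an isomorphism on an open `⊇ ρ⁻¹(V_k)` (surjective by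
Nakayama between locally free modules of the same rank), which contains `ρ⁻¹V'` for an open
`V' ⊇ V_k` (`ρ` closed); hence `(ρ_*E')|_{V'} ≅ ρ_*𝒪^e = 𝒪^e` by `ρ_*𝒪 = 𝒪`; so `ρ_*E'` is locally
free on an open `⊇ X_k`, i.e. everywhere (GW II Lemma 24.96). Level one: `(ρ_*E')/p ↪ ρ_{1*}(E'/p) ≅
ρ_{1*}ρ_1^*(E 0)` and `E 0 ↪ ρ_{1*}ρ_1^*(E 0)` have the same image (checked on the `V'`, using the
level-`(c+1)` isomorphism reduced mod `p` as the comparison). EGA III₁ 4.1.5; GW II 24.95/24.96;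
Stacks 02OB/02OC, 0AY8. Size L. -/
def PushforwardTransport : Prop :=
  ModuleBockstein →
  ∀ (p : ℕ) [Fact p.Prime] (k : Type) [Field k] [CharP k p] [PerfectRing k p]
    (𝒳 : SchemeOver (WittVector p k)), IsProper 𝒳.hom →
    ∀ (𝒳' : SchemeOver (WittVector p k)) (ρ : 𝒳' ⟶ 𝒳), IsProper ρ.left →
      (∀ U : 𝒳.left.Opens, IsIso (ρ.left.app U)) → ChowLemmaRing.IsProjOver 𝒳' → Flat 𝒳'.hom →
      ∀ (E : ∀ n : ℕ, (thickening 𝒳 (n + 1)).left.Modules), (∀ n, IsVectorBundle (E n)) →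
        (∀ n, Nonempty ((Scheme.Modules.pullback (thickeningMap 𝒳 (Nat.le_succ (n + 1)))).obj
          (E (n + 1)) ≅ E n)) →
        ∀ (E' : 𝒳'.left.Modules), IsVectorBundle E' →
          (∀ n, Nonempty ((Scheme.Modules.pullback (thickeningι 𝒳' (n + 1))).obj E' ≅
            (Scheme.Modules.pullback
              ((baseChange (WittVector p k) (wittQuot p k (n + 1))).map ρ).left).obj (E n))) →
          IsVectorBundle ((Scheme.Modules.pushforward ρ.left).obj E') ∧
            Nonempty ((Scheme.Modules.pullback (thickeningι 𝒳 1)).obj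
              ((Scheme.Modules.pushforward ρ.left).obj E') ≅ E 0)

/-! ## §2 The registered stubs (`sorry` lives only in these seven theorems)

Each restates its §1 statement VERBATIM over tree / Mathlib declarations (so that a stub worker can
land it as stated under `Theorems/`); the `example`s below check that each restatement is
definitionally the named statement. -/

/-- **STUB FRAME · `stub_chowCoverNormal`** (L) — see `ChowCoverNormal`. LANDED (p81696, worker w-frame,
`Theorems/PadicSemiregularLiftFormalVectorBundlesAlgebraizeChowCoverNormal.lean`); restated here by name. -/
theorem stub_chowCoverNormal :
    ∀ (p : ℕ) [Fact p.Prime] (k : Type) [Field k] [CharP k p] [PerfectRing k p] (d : ℕ)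
      (𝒳 : SchemeOver (WittVector p k)), IsSmoothProperModel d 𝒳 →
      ∃ (𝒳' : SchemeOver (WittVector p k)) (ρ : 𝒳' ⟶ 𝒳),
        IsIntegral 𝒳'.left ∧ ChowLemmaRing.IsProjOver 𝒳' ∧ Flat 𝒳'.hom ∧ IsProper ρ.left ∧
          ∀ U : 𝒳.left.Opens, IsIso (ρ.left.app U) :=
  Summit.HodgeConjecture.HodgeConjecture.Theorems.FormalVectorBundlesAlgebraize.stub_chowCoverNormal

/-- **STUB EA · `stub_serreVanishingPackage`** (XL, lead-held) — see `SerreVanishingPackage`. -/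
theorem stub_serreVanishingPackage :
    ∀ (p : ℕ) [Fact p.Prime] (k : Type) [Field k] [CharP k p] [PerfectRing k p]
      (Z : SchemeOver (WittVector p k)), ChowLemmaRing.IsProjOver Z →
      ∃ (ι : Type) (_ : Finite ι) (U : ι → Z.left.Opens),
        (∀ i, IsAffineOpen (U i)) ∧ (⨆ i, U i) = ⊤ ∧
        ∀ (F : (thickening Z 1).left.Modules), IsVectorBundle F →
          ∃ (L : Z.left.Modules), IsVectorBundle L ∧
            (∃ π : L ⟶ (Scheme.Modules.pushforward (thickeningι Z 1)).obj F, Epi π) ∧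
            Subsingleton (CechMH1 Z.hom
              (sheafHom L ((Scheme.Modules.pushforward (thickeningι Z 1)).obj F)) U) := by
  sorry

/-- **STUB EB1 · `stub_towerPresentation`** (L) — see `TowerPresentation`. -/
theorem stub_towerPresentation :
    ∀ (p : ℕ) [Fact p.Prime] (k : Type) [Field k] [CharP k p] [PerfectRing k p]
      (Z : SchemeOver (WittVector p k)), ChowLemmaRing.IsProjOver Z → Flat Z.hom →
      ∀ (ι : Type) [Finite ι] (U : ι → Z.left.Opens), (∀ i, IsAffineOpen (U i)) → (⨆ i, U i) = ⊤ →
      (∀ (F : (thickening Z 1).left.Modules), IsVectorBundle F →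
          ∃ (L : Z.left.Modules), IsVectorBundle L ∧
            (∃ π : L ⟶ (Scheme.Modules.pushforward (thickeningι Z 1)).obj F, Epi π) ∧
            Subsingleton (CechMH1 Z.hom
              (sheafHom L ((Scheme.Modules.pushforward (thickeningι Z 1)).obj F)) U)) →
      ∀ (F : ∀ n : ℕ, (thickening Z (n + 1)).left.Modules), (∀ n, IsVectorBundle (F n)) →
        (∀ n, Nonempty ((Scheme.Modules.pullback (thickeningMap Z (Nat.le_succ (n + 1)))).obj
          (F (n + 1)) ≅ F n)) →
        ∃ (V V' : Z.left.Modules) (u : ∀ n : ℕ,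
            (Scheme.Modules.pullback (thickeningι Z (n + 1))).obj V' ⟶
              (Scheme.Modules.pullback (thickeningι Z (n + 1))).obj V),
          IsVectorBundle V ∧ IsVectorBundle V' ∧
          (∀ n, (Scheme.Modules.pullback (thickeningMap Z (Nat.le_succ (n + 1)))).map (u (n + 1)) =
            (towerRestrictIso Z n V').hom ≫ u n ≫ (towerRestrictIso Z n V).inv) ∧
          ∀ n, Nonempty (cokernel (u n) ≅ F n) := by
  sorry

/-- **STUB EC · `stub_moduleBockstein`** (M–L) — see `ModuleBockstein`. LANDED (p84768, worker w-bockstein,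
`Theorems/PadicSemiregularLiftFormalVectorBundlesAlgebraizeModuleBockstein.lean`). -/
theorem stub_moduleBockstein :
    ∀ (A : Type) [CommRing A] [IsNoetherianRing A] (X : Scheme.{0}) (f : X ⟶ Spec (.of A))
      [IsProper f] (a : A) (M : X.Modules), IsVectorBundle M →
      Mono (globalScalar M (algebraMapΓ f a)) →
      ∃ c : ℕ, ∀ (n : ℕ)
        (r : cokernel (globalScalar M (algebraMapΓ f (a ^ (n + 1 + c)))) ⟶
          cokernel (globalScalar M (algebraMapΓ f (a ^ (n + 1))))),
        cokernel.π (globalScalar M (algebraMapΓ f (a ^ (n + 1 + c)))) ≫ r =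
          cokernel.π (globalScalar M (algebraMapΓ f (a ^ (n + 1)))) →
        ∀ t : Γ(cokernel (globalScalar M (algebraMapΓ f (a ^ (n + 1 + c)))), ⊤),
          ∃ s : Γ(M, ⊤),
            (cokernel.π (globalScalar M (algebraMapΓ f (a ^ (n + 1))))).app ⊤ s = r.app ⊤ t :=
  Summit.HodgeConjecture.HodgeConjecture.Theorems.FormalVectorBundlesAlgebraize.stub_moduleBockstein

/-- **STUB EB2 · `stub_presentationAlgebraize`** (L) — see `PresentationAlgebraize`. -/
theorem stub_presentationAlgebraize :
    ∀ (p : ℕ) [Fact p.Prime] (k : Type) [Field k] [CharP k p] [PerfectRing k p]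
      (Z : SchemeOver (WittVector p k)), ChowLemmaRing.IsProjOver Z → Flat Z.hom →
      (∀ (M : Z.left.Modules), IsVectorBundle M →
        Mono (globalScalar M (algebraMapΓ Z.hom (p : WittVector p k))) →
        ∃ c : ℕ, ∀ (n : ℕ)
          (r : cokernel (globalScalar M (algebraMapΓ Z.hom ((p : WittVector p k) ^ (n + 1 + c)))) ⟶
            cokernel (globalScalar M (algebraMapΓ Z.hom ((p : WittVector p k) ^ (n + 1))))),
          cokernel.π (globalScalar M (algebraMapΓ Z.hom ((p : WittVector p k) ^ (n + 1 + c)))) ≫ r =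
            cokernel.π (globalScalar M (algebraMapΓ Z.hom ((p : WittVector p k) ^ (n + 1)))) →
          ∀ t : Γ(cokernel (globalScalar M (algebraMapΓ Z.hom ((p : WittVector p k) ^ (n + 1 + c)))), ⊤),
            ∃ s : Γ(M, ⊤),
              (cokernel.π (globalScalar M (algebraMapΓ Z.hom ((p : WittVector p k) ^ (n + 1))))).app ⊤ s =
                r.app ⊤ t) →
      ∀ (V V' : Z.left.Modules), IsVectorBundle V → IsVectorBundle V' →
      ∀ (u : ∀ n : ℕ,
          (Scheme.Modules.pullback (thickeningι Z (n + 1))).obj V' ⟶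
            (Scheme.Modules.pullback (thickeningι Z (n + 1))).obj V),
        (∀ n, (Scheme.Modules.pullback (thickeningMap Z (Nat.le_succ (n + 1)))).map (u (n + 1)) =
          (towerRestrictIso Z n V').hom ≫ u n ≫ (towerRestrictIso Z n V).inv) →
        ∃ w : V' ⟶ V, ∀ n, (Scheme.Modules.pullback (thickeningι Z (n + 1))).map w = u n := by
  sorry

/-- **STUB ED · `stub_formallyFreeCokernel`** (M) — see `FormallyFreeCokernel`. LANDED (p89486, worker w-freecoker,
`Theorems/PadicSemiregularLiftFormalVectorBundlesAlgebraizeFormallyFreeCokernel.lean`). -/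
theorem stub_formallyFreeCokernel :
    ∀ (p : ℕ) [Fact p.Prime] (k : Type) [Field k] [CharP k p] [PerfectRing k p]
      (Z : SchemeOver (WittVector p k)), IsProper Z.hom →
      ∀ (V V' : Z.left.Modules) (u : V' ⟶ V), IsVectorBundle V → IsVectorBundle V' →
        (∀ n : ℕ, IsVectorBundle ((Scheme.Modules.pullback (thickeningι Z (n + 1))).obj (cokernel u))) →
        IsVectorBundle (cokernel u) :=
  Summit.HodgeConjecture.HodgeConjecture.Theorems.FormalVectorBundlesAlgebraize.stub_formallyFreeCokernel

/-- **STUB TRANSPORT · `stub_pushforwardTransport`** (L) — see `PushforwardTransport`. -/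
theorem stub_pushforwardTransport :
    (∀ (A : Type) [CommRing A] [IsNoetherianRing A] (X : Scheme.{0}) (f : X ⟶ Spec (.of A))
      [IsProper f] (a : A) (M : X.Modules), IsVectorBundle M →
      Mono (globalScalar M (algebraMapΓ f a)) →
      ∃ c : ℕ, ∀ (n : ℕ)
        (r : cokernel (globalScalar M (algebraMapΓ f (a ^ (n + 1 + c)))) ⟶
          cokernel (globalScalar M (algebraMapΓ f (a ^ (n + 1))))),
        cokernel.π (globalScalar M (algebraMapΓ f (a ^ (n + 1 + c)))) ≫ r =
          cokernel.π (globalScalar M (algebraMapΓ f (a ^ (n + 1)))) →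
        ∀ t : Γ(cokernel (globalScalar M (algebraMapΓ f (a ^ (n + 1 + c)))), ⊤),
          ∃ s : Γ(M, ⊤),
            (cokernel.π (globalScalar M (algebraMapΓ f (a ^ (n + 1))))).app ⊤ s = r.app ⊤ t) →
    ∀ (p : ℕ) [Fact p.Prime] (k : Type) [Field k] [CharP k p] [PerfectRing k p]
      (𝒳 : SchemeOver (WittVector p k)), IsProper 𝒳.hom →
      ∀ (𝒳' : SchemeOver (WittVector p k)) (ρ : 𝒳' ⟶ 𝒳), IsProper ρ.left →
        (∀ U : 𝒳.left.Opens, IsIso (ρ.left.app U)) → ChowLemmaRing.IsProjOver 𝒳' → Flat 𝒳'.hom →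
        ∀ (E : ∀ n : ℕ, (thickening 𝒳 (n + 1)).left.Modules), (∀ n, IsVectorBundle (E n)) →
          (∀ n, Nonempty ((Scheme.Modules.pullback (thickeningMap 𝒳 (Nat.le_succ (n + 1)))).obj
            (E (n + 1)) ≅ E n)) →
          ∀ (E' : 𝒳'.left.Modules), IsVectorBundle E' →
            (∀ n, Nonempty ((Scheme.Modules.pullback (thickeningι 𝒳' (n + 1))).obj E' ≅
              (Scheme.Modules.pullback
                ((baseChange (WittVector p k) (wittQuot p k (n + 1))).map ρ).left).obj (E n))) →
            IsVectorBundle ((Scheme.Modules.pushforward ρ.left).obj E') ∧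
              Nonempty ((Scheme.Modules.pullback (thickeningι 𝒳 1)).obj
                ((Scheme.Modules.pushforward ρ.left).obj E') ≅ E 0) := by
  sorry

/-! ### Consistency: each named statement IS its registered stub (definitionally) -/

example : ChowCoverNormal := stub_chowCoverNormal
example : SerreVanishingPackage := stub_serreVanishingPackage
example : TowerPresentation := stub_towerPresentation
example : ModuleBockstein := stub_moduleBockstein
example : PresentationAlgebraize := stub_presentationAlgebraize
example : FormallyFreeCokernel := stub_formallyFreeCokernel
example : PushforwardTransport := stub_pushforwardTransport

/-! ## §3 Proved glue (no `sorry` from here on)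

### §3.1 Vector bundles: `IsVectorBundle → IsFiniteLocallyFree`, iso-invariance, pull-backs
(PROVED; credit refuter-cdisprove-stmt-HodgeConjecture-13825 — the converse is also LANDED as
`Theorems/FormalLiftingFromClassLifting/Negative/VectorBundleConverse.lean`, to be imported once the
farm has built it; copied here meanwhile so that this file is self-contained) -/

universe u₄ v₄ u₄'

section RankFour

variable {C : Type u₄'} [Category.{v₄} C] {J : GrothendieckTopology C} {R : Sheaf J RingCat.{u₄}}
  [HasWeakSheafify J AddCommGrpCat.{u₄}] [J.WEqualsLocallyBijective AddCommGrpCat.{u₄}]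

/-- Morphisms out of a free sheaf of modules are determined by their restrictions along the
tautological inclusions `ιFree i : 𝒪 ⟶ 𝒪^I`. -/
theorem free_hom_ext {I : Type u₄} {Z : SheafOfModules.{u₄} R} (f g : SheafOfModules.free I ⟶ Z)
    (h : ∀ i, SheafOfModules.ιFree i ≫ f = SheafOfModules.ιFree i ≫ g) : f = g :=
  Cofan.IsColimit.hom_ext (SheafOfModules.isColimitFreeCofan I) _ _ fun i => h i

/-- An epimorphism `𝒪^K ↠ 𝒪^I` of free sheaves of modules with `K` finite forces `I` finite, on any
ringed site whose ring `End(𝒪)` is commutative with `𝟙 ≠ 0` (strong rank condition). -/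
theorem finite_of_epi_free {I K : Type u₄} [Finite K]
    (hcomm : ∀ a b : End (SheafOfModules.unit R), a * b = b * a)
    (hnt : (𝟙 (SheafOfModules.unit R) : End (SheafOfModules.unit R)) ≠ 0)
    (π : SheafOfModules.free (R := R) K ⟶ SheafOfModules.free (R := R) I) [Epi π] : Finite I := by
  classical
  letI : CommRing (End (SheafOfModules.unit R)) :=
    { (inferInstance : Ring (End (SheafOfModules.unit R))) with mul_comm := hcomm }
  haveI : Nontrivial (End (SheafOfModules.unit R)) := ⟨⟨_, _, hnt⟩⟩
  by_contra hI
  rw [not_finite_iff_infinite] at hI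
  haveI := Fintype.ofFinite K
  let emb : Fin (Fintype.card K + 1) ↪ I := Fin.valEmbedding.trans (Infinite.natEmbedding I)
  let δ : (Fin (Fintype.card K + 1) → End (SheafOfModules.unit R)) →
      I → End (SheafOfModules.unit R) :=
    fun c => Function.extend emb c (0 : I → End (SheafOfModules.unit R))
  have hδ_emb : ∀ c j, δ c (emb j) = c j := fun c j => emb.injective.extend_apply c 0 j
  have hδ_out : ∀ c i, (¬ ∃ j, emb j = i) → δ c i = 0 := fun c i hi =>
    Function.extend_apply' c (0 : I → End (SheafOfModules.unit R)) i hi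
  have hδ_add : ∀ c c' i, δ (c + c') i = δ c i + δ c' i := by
    intro c c' i
    by_cases hi : ∃ j, emb j = i
    · obtain ⟨j, rfl⟩ := hi
      rw [hδ_emb, hδ_emb, hδ_emb, Pi.add_apply]
    · rw [hδ_out c i hi, hδ_out c' i hi, hδ_out (c + c') i hi, add_zero]
  have hδ_smul : ∀ (b : End (SheafOfModules.unit R)) c i, δ (b • c) i = b * δ c i := by
    intro b c i
    by_cases hi : ∃ j, emb j = i
    · obtain ⟨j, rfl⟩ := hi
      rw [hδ_emb, hδ_emb, Pi.smul_apply, smul_eq_mul]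
    · rw [hδ_out c i hi, hδ_out (b • c) i hi, mul_zero]
  let D : (Fin (Fintype.card K + 1) → End (SheafOfModules.unit R)) →
      (SheafOfModules.free (R := R) I ⟶ SheafOfModules.unit R) :=
    fun c => Cofan.IsColimit.desc (SheafOfModules.isColimitFreeCofan I)
      (fun i => End.asHom (δ c i))
  have hD : ∀ c i, SheafOfModules.ιFree i ≫ D c = End.asHom (δ c i) :=
    fun c i => Cofan.IsColimit.fac (SheafOfModules.isColimitFreeCofan I) _ i
  have hD_add : ∀ c c', D (c + c') = D c + D c' := by
    intro c c'
    refine free_hom_ext _ _ fun i => ?_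
    rw [Preadditive.comp_add, hD, hD, hD, hδ_add]
    rfl
  have hD_smul : ∀ (b : End (SheafOfModules.unit R)) c, D (b • c) = D c ≫ End.asHom b := by
    intro b c
    refine free_hom_ext _ _ fun i => ?_
    rw [hD, ← Category.assoc, hD, hδ_smul]
    rfl
  let Φ : (Fin (Fintype.card K + 1) → End (SheafOfModules.unit R)) →ₗ[End (SheafOfModules.unit R)]
      (K → End (SheafOfModules.unit R)) :=
    { toFun := fun c k => End.of (SheafOfModules.ιFree k ≫ π ≫ D c)
      map_add' := fun c c' => by
        funext k
        change End.of (SheafOfModules.ιFree k ≫ π ≫ D (c + c')) =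
          End.of (SheafOfModules.ιFree k ≫ π ≫ D c) + End.of (SheafOfModules.ιFree k ≫ π ≫ D c')
        rw [hD_add, Preadditive.comp_add, Preadditive.comp_add]
        rfl
      map_smul' := fun b c => by
        funext k
        change End.of (SheafOfModules.ιFree k ≫ π ≫ D (b • c)) =
          b * End.of (SheafOfModules.ιFree k ≫ π ≫ D c)
        rw [hD_smul, End.mul_def]
        change SheafOfModules.ιFree k ≫ π ≫ D c ≫ End.asHom b =
          (SheafOfModules.ιFree k ≫ π ≫ D c) ≫ End.asHom b
        simp only [Category.assoc] }
  have hΦ : Function.Injective Φ := by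
    intro c c' hcc'
    rw [← sub_eq_zero] at hcc' ⊢
    rw [← map_sub] at hcc'
    have h0 : ∀ k, SheafOfModules.ιFree k ≫ π ≫ D (c - c') = 0 := fun k => congrFun hcc' k
    have h1 : π ≫ D (c - c') = 0 := by
      refine free_hom_ext _ _ fun k => ?_
      rw [comp_zero]
      exact h0 k
    have h2 : D (c - c') = 0 := by
      rw [← cancel_epi π, h1, comp_zero]
    funext j
    have h3 := hD (c - c') (emb j)
    rw [h2, comp_zero, hδ_emb] at h3
    exact h3.symm
  have hcard := card_le_of_injective (End (SheafOfModules.unit R)) Φ hΦ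
  simp only [Fintype.card_fin] at hcard
  omega

end RankFour

section EndUnitFour

open Opposite

variable {X : Scheme.{u₄}} (W : X.Opens)

/-- `End(𝒪)` is commutative on the site of opens over `W` (open by open an endomorphism of the unit
module is multiplication by its value on `1`; sections of `𝒪_X` commute). -/
theorem end_unit_mul_comm (a b : End (SheafOfModules.unit (X.ringCatSheaf.over W))) :
    a * b = b * a := by
  change b ≫ a = a ≫ b
  refine SheafOfModules.hom_ext (PresheafOfModules.hom_ext fun Y => ModuleCat.hom_ext
    (LinearMap.ext fun y => ?_))
  let f : (X.ringCatSheaf.over W).obj.obj Y →ₗ[(X.ringCatSheaf.over W).obj.obj Y]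
      (X.ringCatSheaf.over W).obj.obj Y := (a.val.app Y).hom
  let g : (X.ringCatSheaf.over W).obj.obj Y →ₗ[(X.ringCatSheaf.over W).obj.obj Y]
      (X.ringCatSheaf.over W).obj.obj Y := (b.val.app Y).hom
  obtain ⟨z, rfl⟩ : ∃ z : (X.ringCatSheaf.over W).obj.obj Y, z = y := ⟨y, rfl⟩
  change f (g z) = g (f z)
  have hf : ∀ t, f t = t * f 1 := fun t => by
    have h := f.map_smul t 1
    rwa [smul_eq_mul, mul_one, smul_eq_mul] at h
  have hg : ∀ t, g t = t * g 1 := fun t => by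
    have h := g.map_smul t 1
    rwa [smul_eq_mul, mul_one, smul_eq_mul] at h
  rw [hg z, hf (z * _), hf z, hg (z * _)]
  have key : ∀ r s t : Γ(X, Y.unop.left), r * s * t = r * t * s := fun r s t => mul_right_comm r s t
  exact key _ _ _

/-- `𝟙 ≠ 0` in `End(𝒪)` over a non-empty open `W` of a scheme. -/
theorem end_unit_id_ne_zero [Nonempty W] :
    (𝟙 (SheafOfModules.unit (X.ringCatSheaf.over W)) :
      End (SheafOfModules.unit (X.ringCatSheaf.over W))) ≠ 0 := by
  intro h0
  have key := congrArg (fun u : SheafOfModules.unit (X.ringCatSheaf.over W) ⟶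
      SheafOfModules.unit (X.ringCatSheaf.over W) =>
        ((u.val.app (op (Over.mk (𝟙 W)))).hom
          (1 : (X.ringCatSheaf.over W).obj.obj (op (Over.mk (𝟙 W)))) :
          (X.ringCatSheaf.over W).obj.obj (op (Over.mk (𝟙 W))))) h0
  change (1 : Γ(X, W)) = 0 at key
  exact one_ne_zero key

/-- **A vector bundle on a scheme is finite locally free** (Stacks 01C6; the converse of the tree's
`IsFiniteLocallyFree.isVectorBundle`): at `x`, a trivialisation `E|_U ≅ 𝒪^I` and finitely many
generators of `E|_V` restrict to `W = U ∩ V ∋ x`, giving `𝒪^K ↠ 𝒪^I` over `W ≠ ∅`, whence `I` is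
finite (`finite_of_epi_free`). -/
theorem isFiniteLocallyFree_of_isVectorBundle {E : X.Modules} (h : IsVectorBundle E) :
    IsFiniteLocallyFree E := by
  classical
  obtain ⟨q, hq⟩ := h.1.exists_isLocallyFreeData
  haveI := h.2
  obtain ⟨q', hq'⟩ := SheafOfModules.IsFiniteType.exists_localGeneratorsData E
  intro x
  obtain ⟨a, ha⟩ := ((Opens.coversTop_iff _ q.X).mp q.coversTop).exists_mem x
  obtain ⟨b, hb⟩ := ((Opens.coversTop_iff _ q'.X).mp q'.coversTop).exists_mem x
  refine ⟨q.X a, ha, (q.generators a).I, ?_, ⟨asIso (q.generators a).π⟩⟩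
  let W : X.Opens := q.X a ⊓ q'.X b
  haveI : Nonempty W := ⟨⟨x, ⟨ha, hb⟩⟩⟩
  haveI : (q'.generators b).IsFiniteType := hq'.isFiniteType b
  let eW : SheafOfModules.free (q.generators a).I ≅ E.over W :=
    SheafOfModules.restrictTrivialisation (R := X.ringCatSheaf) (homOfLE inf_le_left)
      (asIso (q.generators a).π)
  let g : W ⟶ q'.X b := homOfLE inf_le_right
  let πW : SheafOfModules.free (q'.generators b).I ⟶ E.over W :=
    (SheafOfModules.mapFreeIso (SheafOfModules.overMap X.ringCatSheaf g) _
        (SheafOfModules.overMapUnitIso g).symm).hom ≫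
      (SheafOfModules.overMap X.ringCatSheaf g).map (q'.generators b).π ≫
        ((SheafOfModules.overFunctorMap X.ringCatSheaf g).app E).hom
  haveI : Epi πW := by
    dsimp only [πW]
    infer_instance
  exact finite_of_epi_free (end_unit_mul_comm W) (end_unit_id_ne_zero W) (πW ≫ eW.inv)

end EndUnitFour


section VectorBundles

variable {X Y : Scheme.{u₄}}

/-- Finite local freeness is invariant under isomorphism. -/
theorem isFiniteLocallyFree_congr {E E' : X.Modules} (e : E ≅ E') (h : IsFiniteLocallyFree E) :
    IsFiniteLocallyFree E' := fun x => by
  obtain ⟨U, hx, I, hI, ⟨i⟩⟩ := h x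
  exact ⟨U, hx, I, hI, ⟨i ≪≫ (Scheme.Modules.overFunctor U).mapIso e⟩⟩

/-- Being a vector bundle is invariant under isomorphism. -/
theorem isVectorBundle_congr {E E' : X.Modules} (e : E ≅ E') (h : IsVectorBundle E) :
    IsVectorBundle E' :=
  (isFiniteLocallyFree_congr e (isFiniteLocallyFree_of_isVectorBundle h)).isVectorBundle

/-- **Pull-backs of vector bundles are vector bundles** (Stacks 01C8). -/
theorem isVectorBundle_pullback (f : X ⟶ Y) {E : Y.Modules} (h : IsVectorBundle E) :
    IsVectorBundle ((Scheme.Modules.pullback f).obj E) :=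
  ((isFiniteLocallyFree_of_isVectorBundle h).pullback f).isVectorBundle

end VectorBundles

/-! ### §3.2 Tower bookkeeping: the base-changed morphism `ρ_n` and the transition maps -/

section Tower

variable {p : ℕ} [Fact p.Prime] {k : Type} [Field k]

/-- `ρ_n ≫ (X_n ⟶ 𝒳) = (X'_n ⟶ 𝒳') ≫ ρ` for the base change `ρ_n : X'_n ⟶ X_n` of a `W`-morphism. -/
theorem baseChange_map_left_ι {𝒳' 𝒳 : SchemeOver (WittVector p k)} (ρ : 𝒳' ⟶ 𝒳) (n : ℕ) :
    ((baseChange (WittVector p k) (wittQuot p k n)).map ρ).left ≫ thickeningι 𝒳 n =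
      thickeningι 𝒳' n ≫ ρ.left :=
  pullback.lift_fst _ _ _

/-- `ρ_n` lies over the identity of `Spec W_n`. -/
theorem baseChange_map_left_snd {𝒳' 𝒳 : SchemeOver (WittVector p k)} (ρ : 𝒳' ⟶ 𝒳) (n : ℕ) :
    ((baseChange (WittVector p k) (wittQuot p k n)).map ρ).left ≫ pullback.snd 𝒳.hom
        (Spec.map (CommRingCat.ofHom (algebraMap (WittVector p k) (wittQuot p k n)))) =
      pullback.snd 𝒳'.hom
        (Spec.map (CommRingCat.ofHom (algebraMap (WittVector p k) (wittQuot p k n)))) :=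
  pullback.lift_snd _ _ _

/-- **Naturality of the tower**: `ρ_m ≫ (X_m ⟶ X_n) = (X'_m ⟶ X'_n) ≫ ρ_n`. -/
theorem baseChange_map_left_thickeningMap {𝒳' 𝒳 : SchemeOver (WittVector p k)} (ρ : 𝒳' ⟶ 𝒳)
    {m n : ℕ} (h : m ≤ n) :
    ((baseChange (WittVector p k) (wittQuot p k m)).map ρ).left ≫ thickeningMap 𝒳 h =
      thickeningMap 𝒳' h ≫ ((baseChange (WittVector p k) (wittQuot p k n)).map ρ).left := by
  apply pullback.hom_ext
  · have hl : (((baseChange (WittVector p k) (wittQuot p k m)).map ρ).left ≫ thickeningMap 𝒳 h) ≫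
        thickeningι 𝒳 n = thickeningι 𝒳' m ≫ ρ.left :=
      (Category.assoc _ _ _).trans <|
        (congrArg (((baseChange (WittVector p k) (wittQuot p k m)).map ρ).left ≫ ·)
          (thickeningMap_ι 𝒳 h)).trans (baseChange_map_left_ι ρ m)
    have hr : (thickeningMap 𝒳' h ≫ ((baseChange (WittVector p k) (wittQuot p k n)).map ρ).left) ≫
        thickeningι 𝒳 n = thickeningι 𝒳' m ≫ ρ.left :=
      (Category.assoc _ _ _).trans <|
        (congrArg (thickeningMap 𝒳' h ≫ ·) (baseChange_map_left_ι ρ n)).trans <|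
          (Category.assoc _ _ _).symm.trans (congrArg (· ≫ ρ.left) (thickeningMap_ι 𝒳' h))
    exact hl.trans hr.symm
  · have hl : (((baseChange (WittVector p k) (wittQuot p k m)).map ρ).left ≫ thickeningMap 𝒳 h) ≫
        pullback.snd 𝒳.hom (Spec.map (CommRingCat.ofHom (algebraMap (WittVector p k) (wittQuot p k n)))) =
        pullback.snd 𝒳'.hom (Spec.map (CommRingCat.ofHom (algebraMap (WittVector p k) (wittQuot p k m)))) ≫
          Spec.map (CommRingCat.ofHom (Ideal.Quotient.factor
            (Ideal.pow_le_pow_right (I := Ideal.span {(p : WittVector p k)}) h))) :=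
      (Category.assoc _ _ _).trans <|
        (congrArg (((baseChange (WittVector p k) (wittQuot p k m)).map ρ).left ≫ ·)
          (thickeningMap_snd 𝒳 h)).trans <|
          (Category.assoc _ _ _).symm.trans
            (congrArg (· ≫ Spec.map (CommRingCat.ofHom (Ideal.Quotient.factor
              (Ideal.pow_le_pow_right (I := Ideal.span {(p : WittVector p k)}) h))))
              (baseChange_map_left_snd ρ m))
    have hr : (thickeningMap 𝒳' h ≫ ((baseChange (WittVector p k) (wittQuot p k n)).map ρ).left) ≫
        pullback.snd 𝒳.hom (Spec.map (CommRingCat.ofHom (algebraMap (WittVector p k) (wittQuot p k n)))) =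
        pullback.snd 𝒳'.hom (Spec.map (CommRingCat.ofHom (algebraMap (WittVector p k) (wittQuot p k m)))) ≫
          Spec.map (CommRingCat.ofHom (Ideal.Quotient.factor
            (Ideal.pow_le_pow_right (I := Ideal.span {(p : WittVector p k)}) h))) :=
      (Category.assoc _ _ _).trans <|
        (congrArg (thickeningMap 𝒳' h ≫ ·) (baseChange_map_left_snd ρ n)).trans (thickeningMap_snd 𝒳' h)
    exact hl.trans hr.symm

/-- One step of the PULLED-BACK tower: from `E (n+1)|_{X_{n+1}} ≅ E n` to
`(ρ_{n+2}^* E (n+1))|_{X'_{n+1}} ≅ ρ_{n+1}^* E n`. -/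
theorem towerPullbackStep {𝒳' 𝒳 : SchemeOver (WittVector p k)} (ρ : 𝒳' ⟶ 𝒳)
    (E : ∀ n : ℕ, (thickening 𝒳 (n + 1)).left.Modules) (n : ℕ)
    (s : (Scheme.Modules.pullback (thickeningMap 𝒳 (Nat.le_succ (n + 1)))).obj (E (n + 1)) ≅ E n) :
    Nonempty ((Scheme.Modules.pullback (thickeningMap 𝒳' (Nat.le_succ (n + 1)))).obj
        ((Scheme.Modules.pullback
          ((baseChange (WittVector p k) (wittQuot p k (n + 1 + 1))).map ρ).left).obj (E (n + 1))) ≅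
      (Scheme.Modules.pullback
        ((baseChange (WittVector p k) (wittQuot p k (n + 1))).map ρ).left).obj (E n)) := by
  let t' := thickeningMap 𝒳' (Nat.le_succ (n + 1))
  let t := thickeningMap 𝒳 (Nat.le_succ (n + 1))
  let ρ₂ := ((baseChange (WittVector p k) (wittQuot p k (n + 1 + 1))).map ρ).left
  let ρ₁ := ((baseChange (WittVector p k) (wittQuot p k (n + 1))).map ρ).left
  have sq : t' ≫ ρ₂ = ρ₁ ≫ t := (baseChange_map_left_thickeningMap ρ (Nat.le_succ (n + 1))).symm
  have i1 : (Scheme.Modules.pullback t').obj ((Scheme.Modules.pullback ρ₂).obj (E (n + 1))) ≅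
      (Scheme.Modules.pullback (t' ≫ ρ₂)).obj (E (n + 1)) :=
    (Scheme.Modules.pullbackComp t' ρ₂).app (E (n + 1))
  have i2 : (Scheme.Modules.pullback (t' ≫ ρ₂)).obj (E (n + 1)) ≅
      (Scheme.Modules.pullback (ρ₁ ≫ t)).obj (E (n + 1)) :=
    (Scheme.Modules.pullbackCongr sq).app (E (n + 1))
  have i3 : (Scheme.Modules.pullback (ρ₁ ≫ t)).obj (E (n + 1)) ≅
      (Scheme.Modules.pullback ρ₁).obj ((Scheme.Modules.pullback t).obj (E (n + 1))) :=
    ((Scheme.Modules.pullbackComp ρ₁ t).app (E (n + 1))).symm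
  have i4 : (Scheme.Modules.pullback ρ₁).obj ((Scheme.Modules.pullback t).obj (E (n + 1))) ≅
      (Scheme.Modules.pullback ρ₁).obj (E n) :=
    (Scheme.Modules.pullback ρ₁).mapIso s
  exact ⟨i1 ≪≫ i2 ≪≫ i3 ≪≫ i4⟩

end Tower

section Glue

variable {p : ℕ} [Fact p.Prime] {k : Type} [Field k] [CharP k p]

/-- **Last glue step:** a vector bundle `G` on `𝒳` with `G|_{X_1} ≅ E 0` and `E 0|_{X_k} ≅ E₁`
witnesses `LiftsTo 𝒳 E₁` (`X_k ⟶ X_1 ⟶ 𝒳 = X_k ⟶ 𝒳`, `specialFibreToThickening_ι`). -/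
theorem liftsTo_of_levelOne (𝒳 : SchemeOver (WittVector p k)) (G : 𝒳.left.Modules)
    (hG : IsVectorBundle G) (E₁ : (specialFibre 𝒳).left.Modules)
    (E0 : (thickening 𝒳 1).left.Modules)
    (e : (Scheme.Modules.pullback (thickeningι 𝒳 1)).obj G ≅ E0)
    (e₀ : (Scheme.Modules.pullback (specialFibreToThickening 𝒳 0)).obj E0 ≅ E₁) :
    LiftsTo 𝒳 E₁ :=
  ⟨G, hG, ⟨(Scheme.Modules.pullbackCongr (specialFibreToThickening_ι 𝒳 0).symm).app G ≪≫
      ((Scheme.Modules.pullbackComp (specialFibreToThickening 𝒳 0) (thickeningι 𝒳 1)).app G).symm ≪≫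
      (Scheme.Modules.pullback (specialFibreToThickening 𝒳 0)).mapIso e ≪≫ e₀⟩⟩

end Glue

/-! ## §4 The compositions (kernel-checked; no `sorry`) -/

/-- **The engine's target** (planner's `ProjectiveFlatEngineStrong`, verbatim): on a `W`-FLAT closed
`Z ⊆ ℙᴺ_W`, every tower of vector bundles with level-wise `Nonempty` transitions is level-wise the
restriction of ONE vector bundle on `Z`. -/
def ProjectiveFlatEngineStrong : Prop :=
  ∀ (p : ℕ) [Fact p.Prime] (k : Type) [Field k] [CharP k p] [PerfectRing k p]
    (Z : SchemeOver (WittVector p k)), ChowLemmaRing.IsProjOver Z → Flat Z.hom →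
    ∀ (F : ∀ n : ℕ, (thickening Z (n + 1)).left.Modules), (∀ n, IsVectorBundle (F n)) →
      (∀ n, Nonempty ((Scheme.Modules.pullback (thickeningMap Z (Nat.le_succ (n + 1)))).obj (F (n + 1))
        ≅ F n)) →
      ∃ E : Z.left.Modules, IsVectorBundle E ∧
        ∀ n, Nonempty ((Scheme.Modules.pullback (thickeningι Z (n + 1))).obj E ≅ F n)

/-- **ENGINE COMPOSITION** — Serre package (EA) → tower presentation (EB1) → algebraization of the
presentation (EB2, fed with the module Bockstein lemma EC on `Z`) → the cokernel `G := coker w`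
restricts to the tower (`G|Z_{n+1} ≅ coker (w|Z_{n+1}) = coker u_n ≅ F n`: pull-back is a left
adjoint, `PreservesCokernel.iso`, `cokernelIsoOfEq`) → `G` is a vector bundle (ED). -/
theorem engine_of_stubs (hEA : SerreVanishingPackage) (hEB1 : TowerPresentation)
    (hEC : ModuleBockstein) (hEB2 : PresentationAlgebraize) (hED : FormallyFreeCokernel) :
    ProjectiveFlatEngineStrong := by
  intro p _ k _ _ _ Z hZ hflat F hF hstep
  obtain ⟨ι, hι, U, hU, hcov, hAB⟩ := hEA p k Z hZ
  haveI := hι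
  obtain ⟨V, V', u, hV, hV', hcompat, hcoker⟩ := hEB1 p k Z hZ hflat ι U hU hcov hAB F hF hstep
  haveI : IsProper Z.hom := hZ.isProper
  obtain ⟨w, hw⟩ := hEB2 p k Z hZ hflat
    (fun M hM hmono => hEC (WittVector p k) Z.left Z.hom (p : WittVector p k) M hM hmono)
    V V' hV hV' u hcompat
  have e : ∀ n, (Scheme.Modules.pullback (thickeningι Z (n + 1))).obj (cokernel w) ≅ F n := fun n =>
    PreservesCokernel.iso (Scheme.Modules.pullback (thickeningι Z (n + 1))) w ≪≫
      cokernelIsoOfEq (hw n) ≪≫ Classical.choice (hcoker n)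
  refine ⟨cokernel w, ?_, fun n => ⟨e n⟩⟩
  exact hED p k Z hZ.isProper V V' w hV hV' fun n => isVectorBundle_congr (e n).symm (hF n)

/-- **`FormalVectorBundlesAlgebraize_of`** — the crux BY NAME, hypothesis-free, from the seven
registered stubs (`sorryAx` enters only through them). Given a smooth proper model `𝒳`, a module `E₁`
on `X_k` and a formal lift `(E n)`: FRAME gives the Chow cover `ρ : 𝒳' ⟶ 𝒳` (`𝒳'` integral,
`W`-projective, `W`-flat, `ρ` proper, `ρ_*𝒪 = 𝒪`); the tower is pulled back to `𝒳'`
(`isVectorBundle_pullback`, `towerPullbackStep`); the ENGINE (`engine_of_stubs`) algebraizes it on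
`𝒳'`; TRANSPORT pushes the result forward to a vector bundle on `𝒳` restricting to `E 0` on `X_1`;
`liftsTo_of_levelOne` concludes. Shape = Disproof.lean's `crux_of_grothendieckExistenceVB`. -/
theorem FormalVectorBundlesAlgebraize_of :
    Summit.HodgeConjecture.HodgeConjecture.Theses.PadicSemiregularLift.FormalVectorBundlesAlgebraize := by
  intro p _ k _ _ _ d 𝒳 h𝒳 E₁ hE
  obtain ⟨E, hEvb, hstep, ⟨e0⟩⟩ := hE
  obtain ⟨𝒳', ρ, _hint', hproj, hflat, hρp, happ⟩ := stub_chowCoverNormal p k d 𝒳 h𝒳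
  -- the pulled-back tower `F n := ρ_{n+1}^* (E n)` on `𝒳'`
  let F : ∀ n : ℕ, (thickening 𝒳' (n + 1)).left.Modules := fun n =>
    (Scheme.Modules.pullback ((baseChange (WittVector p k) (wittQuot p k (n + 1))).map ρ).left).obj (E n)
  have hFvb : ∀ n, IsVectorBundle (F n) := fun n => isVectorBundle_pullback _ (hEvb n)
  have hFstep : ∀ n, Nonempty ((Scheme.Modules.pullback (thickeningMap 𝒳' (Nat.le_succ (n + 1)))).obj
      (F (n + 1)) ≅ F n) := fun n => by
    obtain ⟨s⟩ := hstep n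
    exact towerPullbackStep ρ E n s
  -- ENGINE on the Chow cover, TRANSPORT back to `𝒳`, conclude at level one
  obtain ⟨E', hE'vb, hE'⟩ := engine_of_stubs stub_serreVanishingPackage stub_towerPresentation
    stub_moduleBockstein stub_presentationAlgebraize stub_formallyFreeCokernel p k 𝒳' hproj hflat F
    hFvb hFstep
  obtain ⟨hG, ⟨e⟩⟩ := stub_pushforwardTransport stub_moduleBockstein p k 𝒳 h𝒳.isProper 𝒳' ρ hρp
    happ hproj hflat E hEvb hstep E' hE'vb hE'
  exact liftsTo_of_levelOne 𝒳 _ hG E₁ (E 0) e e0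

end Summit.HodgeConjecture.HodgeConjecture.Cruxes.FormalVectorBundlesAlgebraize.ChowZariskiPushforward

end
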